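import Literature.MathematicalPhysics.QuantumFieldTheory.Balaban1983to89.B12QPrime348
import Literature.MathematicalPhysics.QuantumFieldTheory.Balaban1983to89.B7Eq31BCH

/-!
# `Balaban1983to89.B12Spaces329BCH` — T. Bałaban, *Renormalization group approach to lattice gauge field theories. I*,
Commun. Math. Phys. **109** (1987) 249–301 [Balaban1987RG1]: the SECOND-INCREMENT (bilinear Lipschitz) bound of the
Baker–Campbell–Hausdorff remainder `G(X, Y) = log(e^X e^Y) − X − Y` behind the «sufficiently small neighborhood of G-valued
transformations» clause of (3.29) p. 276 — `‖G(X₁,Y₁) − G(X₂,Y₁) − G(X₁,Y₂) + G(X₂,Y₂)‖ ≤ 4‖X₁ − X₂‖‖Y₁ − Y₂‖` on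
`‖Xᵢ‖ + ‖Yⱼ‖ ≤ 1/8`, hence `‖G(X₁,Y₁) − G(X₂,Y₂)‖ ≤ 4(a′‖X₁ − X₂‖ + a‖Y₁ − Y₂‖)` (PROVED; [Balaban1985Averaging] (31) p. 22
`|log e^Xe^Y − X − Y| ≤ 2|X||Y|` is the zeroth order, the tree's `B7Eq31BCH.eq31_of_sum_le` BY NAME), and the sharpened
covariant-difference bound for the composed potential `newPot ξ A A′ = (iξ)⁻¹log(e^{iξA}e^{iξA′})` of `B12Membership313II`

HONEST FRAMING (cell `lit-balaban`, verbatim): statement-level skeleton of published theorems with citation tags; proofs where landed; nothing here is a claim about the Yang–Mills mass gap.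

PDF held: `paper:balaban1987-cmp109-rg-i-small-field` (journal page = PDF page + 248), pp. 262, 276 read from the text layer;
`paper:balaban1985-cmp98-averaging` (journal page = PDF page + 16), p. 22 quoted from the tree's `B7Eq31BCH` header (render re-read there).

WHAT IS REPRODUCED.  Nothing of the papers is asserted here.  This is the analysis toolkit (all statements folklore-level, over an arbitrary
complete normed `ℂ`-algebra `𝔸`, no commutativity, no `‖1‖ = 1`) for the sibling `B12Spaces329NearSharp`, which re-proves the «proper spaces»
clause of (3.29) for the CONCRETE conditions (i)–(iii) of `B12RegularSpaces111` (rows `B12.Eq3.28-3.29`, `B12.Eq1.11-1.14`; p07 gen 4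
`B12Spaces329Near.satisfiesI_III_act_near`, p248664) with constants CONTINUOUS at the `G`-valued transformations.  The gen-4 theorem carries the
Lipschitz constant `1 + 3(a + a′)` of the tree's `B12Membership313II.norm_bchRem_sub_bchRem_le` («‖G(X₁,Y₁) − G(X₂,Y₂)‖ ≤ 3(a+a′)(‖X₁−X₂‖ +
‖Y₁−Y₂‖)»), so that its admissible `α₁′` stays a factor `1 + 11ξα₁` above `α₁` even for transformations arbitrarily close to `G`-valued ones;
the bilinear form proved here (`4a′‖X₁−X₂‖ + 4a‖Y₁−Y₂‖`: the `X`-Lipschitz constant is small with `Y` and conversely, because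
`G(X, 0) = G(0, Y) = 0`) removes that defect.  The `[cite:]` tags mark the TEXT LOCATIONS whose objects the lemmas are about
([Balaban1985Averaging] (30)–(31) p. 22 for the remainder `Z − X − Y` of `Z = log e^Xe^Y`; [Balaban1987RG1] (1.13) p. 262 / (3.29) p. 276 for
the composed potential and its covariant derivative); every proof is ours, from Mathlib and the landed modules `B12Membership313II` (`bchLog`,
`newPot`, `hasSum_logOnePlus_sub_self`, `norm_logSeriesCoeff_succ_mul`, `norm_pow_succ_sub_pow_succ_le'`, `norm_expTail_sub_expTail_le`,
`norm_exp_mul_exp_sub_one_le_of_le`, `conj_newPot_sub_newPot_eq`), `B12QPrime348` (`bchLog_zero_left/right`: `log ∘ exp = id`, from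
`B7BlockAvgLog.mlog_exp`), `B7Eq31BCH` (`eq31_of_sum_le`), `B12Membership314`, `Beta.TransportVertices`, BY NAME.

THE PRINT, verbatim.  [Balaban1987RG1] p. 276: *«The functions (3.25), (3.26) are gauge invariant with respect to the simultaneous gauge
transformations 𝐔 → 𝐔^u, 𝐉 → R(u)𝐉, B → R(u)B, (3.29)  for Gᶜ-valued transformations u in a sufficiently small neighborhood of G-valued
transformations, so that the configurations after the transformations belong to proper spaces also.»*  p. 262, condition (ii): *«U′ = exp iξA′,
A′ has values in the algebra 𝔤ᶜ, |A′|, |∇^ξ_U A′| < α₁ on X. (1.13)»*.  [Balaban1985Averaging] p. 22: *«From the structure of this power series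
expansion, we get easily the bound |Z − X − Y − ½[X, Y]| ≤ O(1)(|X|²|Y| + |X||Y|²), (30) and this implies |Z − X − Y| ≤ 2|X||Y| for
|X|, |Y| ≤ c₁, (31)»* (`Z = log e^X e^Y`).

THE MECHANISM (ours; print gives none).  For a two-variable function write `Δ²f = f(X₁,Y₁) − f(X₂,Y₁) − f(X₁,Y₂) + f(X₂,Y₂)`.  With
`w = e^X e^Y − 1`:  `G = (w − X − Y) + (log(1+w) − w)`, `Δ²(w − X − Y) = Δ²w = (e^{X₁} − e^{X₂})(e^{Y₁} − e^{Y₂})` (the linear terms cancel),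
and `log(1+w) − w = Σ_{n≥2} c_n wⁿ` termwise: a noncommutative PRODUCT RULE for second increments (`incr2_mul_eq`:
`Δ²(fg) = Δ²f·g₁₁ + (f₁₂ − f₂₂)(g₁₁ − g₁₂) + (f₂₁ − f₂₂)(g₁₁ − g₂₁) + f₂₂·Δ²g`) gives by induction
`‖Δ²(w^{n+2})‖ ≤ (n+2)ρ^{n+1}m + (n+1)(n+2)ρⁿpq` for `‖w_{ij}‖ ≤ ρ`, first increments `≤ p` (in `X`), `≤ q` (in `Y`), `‖Δ²w‖ ≤ m`, hence
`‖Δ²(log(1+w) − w)‖ ≤ ρm/(1−ρ) + pq/(1−ρ)²` (`|c_n|·n = 1`, two geometric sums); with `ρ = e^{a+a′} − 1`, `p = e^{a+a′}‖X₁−X₂‖`,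
`q = e^{a+a′}‖Y₁−Y₂‖`, `m = e^{a+a′}‖X₁−X₂‖‖Y₁−Y₂‖` and `a + a′ ≤ 1/8` the constant is `e^r/(2−e^r) + e^{2r}/(2−e^r)² ≤ 4`.  The bilinear
Lipschitz bound follows from `G(X, 0) = G(0, Y) = 0` (`log e^X = X`): `G(X₁,Y) − G(X₂,Y) = Δ²G` at `(Y, 0)`.  No `Prop` placeholder, no
definition, no new fact; axioms standard.  Unit `lit-balaban-p07` (Phase-2 seat p07 gen 5; TAKING line HOME/STATUS.md 2026-08-21T05:21:42Z), HOME
`run/shared/lean/pub/lit-balaban/`.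
-/

namespace Literature.MathematicalPhysics.QuantumFieldTheory.Balaban1983to89.B12Spaces329BCH

open NormedSpace
open Literature.Analysis.Complex (logSeriesCoeff logOnePlus)
open Literature.MathematicalPhysics.QuantumFieldTheory.Balaban1983to89
open Literature.MathematicalPhysics.QuantumFieldTheory.Balaban1983to89.Beta.TransportVertices (expTail norm_exp_mul_le)
open Literature.MathematicalPhysics.QuantumFieldTheory.Balaban1983to89.B12Membership314
open Literature.MathematicalPhysics.QuantumFieldTheory.Balaban1983to89.B12Membership313II
open Literature.MathematicalPhysics.QuantumFieldTheory.Balaban1983to89.B12QPrime348 (bchLog_zero_left bchLog_zero_right)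
open Complex (I)

noncomputable section

variable {𝔸 : Type*} [NormedRing 𝔸] [NormedAlgebra ℂ 𝔸] [CompleteSpace 𝔸]

/-! ## §1. Second increments in a normed ring: product rule, powers, the logarithmic tail -/

omit [NormedAlgebra ℂ 𝔸] [CompleteSpace 𝔸] in
/-- **Product rule for second increments** (noncommutative): with `f_{ij}`, `g_{ij}` the four values of two functions,
`Δ²(fg) = Δ²f·g₁₁ + (f₁₂ − f₂₂)(g₁₁ − g₁₂) + (f₂₁ − f₂₂)(g₁₁ − g₂₁) + f₂₂·Δ²g`. [folklore] -/
private theorem incr2_mul_eq (f₁₁ f₂₁ f₁₂ f₂₂ g₁₁ g₂₁ g₁₂ g₂₂ : 𝔸) :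
    f₁₁ * g₁₁ - f₂₁ * g₂₁ - f₁₂ * g₁₂ + f₂₂ * g₂₂ =
      (f₁₁ - f₂₁ - f₁₂ + f₂₂) * g₁₁ + (f₁₂ - f₂₂) * (g₁₁ - g₁₂) + (f₂₁ - f₂₂) * (g₁₁ - g₂₁) +
        f₂₂ * (g₁₁ - g₂₁ - g₁₂ + g₂₂) := by
  noncomm_ring

omit [NormedAlgebra ℂ 𝔸] [CompleteSpace 𝔸] in
/-- **Norm form of the product rule**: `‖Δ²(fg)‖ ≤ ‖Δ²f‖‖g₁₁‖ + ‖f₁₂ − f₂₂‖‖g₁₁ − g₁₂‖ + ‖f₂₁ − f₂₂‖‖g₁₁ − g₂₁‖ + ‖f₂₂‖‖Δ²g‖`.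
[folklore] -/
private theorem norm_incr2_mul_le (f₁₁ f₂₁ f₁₂ f₂₂ g₁₁ g₂₁ g₁₂ g₂₂ : 𝔸) :
    ‖f₁₁ * g₁₁ - f₂₁ * g₂₁ - f₁₂ * g₁₂ + f₂₂ * g₂₂‖ ≤
      ‖f₁₁ - f₂₁ - f₁₂ + f₂₂‖ * ‖g₁₁‖ + ‖f₁₂ - f₂₂‖ * ‖g₁₁ - g₁₂‖ + ‖f₂₁ - f₂₂‖ * ‖g₁₁ - g₂₁‖ +
        ‖f₂₂‖ * ‖g₁₁ - g₂₁ - g₁₂ + g₂₂‖ := by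
  rw [incr2_mul_eq]
  refine norm_add_le_of_le (norm_add₃_le.trans ?_) (norm_mul_le _ _)
  gcongr <;> exact norm_mul_le _ _

omit [NormedAlgebra ℂ 𝔸] [CompleteSpace 𝔸] in
/-- **Second increments of powers.**  If the four letters satisfy `‖w_{ij}‖ ≤ ρ`, the first increments `‖w₁ⱼ − w₂ⱼ‖ ≤ p`,
`‖w_{i1} − w_{i2}‖ ≤ q` and the second increment `‖w₁₁ − w₂₁ − w₁₂ + w₂₂‖ ≤ m`, then for every `n`
`‖Δ²(w^{n+2})‖ ≤ (n+2)ρ^{n+1}m + (n+1)(n+2)ρⁿpq` (induction with the product rule; the Lipschitz bound of powers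
`B12Membership313II.norm_pow_succ_sub_pow_succ_le'`). [folklore] -/
private theorem norm_incr2_pow_le {w₁₁ w₂₁ w₁₂ w₂₂ : 𝔸} {ρ p q m : ℝ} (h₁₁ : ‖w₁₁‖ ≤ ρ) (h₂₁ : ‖w₂₁‖ ≤ ρ)
    (h₁₂ : ‖w₁₂‖ ≤ ρ) (h₂₂ : ‖w₂₂‖ ≤ ρ) (hp₁ : ‖w₁₁ - w₂₁‖ ≤ p) (hp₂ : ‖w₁₂ - w₂₂‖ ≤ p) (hq₁ : ‖w₁₁ - w₁₂‖ ≤ q)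
    (hq₂ : ‖w₂₁ - w₂₂‖ ≤ q) (hm : ‖w₁₁ - w₂₁ - w₁₂ + w₂₂‖ ≤ m) (n : ℕ) :
    ‖w₁₁ ^ (n + 2) - w₂₁ ^ (n + 2) - w₁₂ ^ (n + 2) + w₂₂ ^ (n + 2)‖ ≤
      (n + 2) * ρ ^ (n + 1) * m + (n + 1) * (n + 2) * ρ ^ n * p * q := by
  have hρ : 0 ≤ ρ := (norm_nonneg _).trans h₁₁
  have hp : 0 ≤ p := (norm_nonneg _).trans hp₁
  have hq : 0 ≤ q := (norm_nonneg _).trans hq₁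
  have hm0 : 0 ≤ m := (norm_nonneg _).trans hm
  induction n with
  | zero =>
    have h := norm_incr2_mul_le w₁₁ w₂₁ w₁₂ w₂₂ w₁₁ w₂₁ w₁₂ w₂₂
    have e : ∀ w : 𝔸, w ^ (0 + 2) = w * w := fun w => by rw [Nat.zero_add, pow_two]
    rw [e, e, e, e]
    have t1 := mul_le_mul hm h₁₁ (norm_nonneg _) hm0
    have t2 := mul_le_mul hp₂ hq₁ (norm_nonneg _) hp
    have t3 := mul_le_mul hq₂ hp₁ (norm_nonneg _) hq
    have t4 := mul_le_mul h₂₂ hm (norm_nonneg _) hρ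
    calc ‖w₁₁ * w₁₁ - w₂₁ * w₂₁ - w₁₂ * w₁₂ + w₂₂ * w₂₂‖
        ≤ ‖w₁₁ - w₂₁ - w₁₂ + w₂₂‖ * ‖w₁₁‖ + ‖w₁₂ - w₂₂‖ * ‖w₁₁ - w₁₂‖ + ‖w₂₁ - w₂₂‖ * ‖w₁₁ - w₂₁‖ +
            ‖w₂₂‖ * ‖w₁₁ - w₂₁ - w₁₂ + w₂₂‖ := h
      _ ≤ m * ρ + p * q + q * p + ρ * m := by linarith
      _ = ((0 : ℕ) + 2 : ℝ) * ρ ^ (0 + 1) * m + ((0 : ℕ) + 1 : ℝ) * ((0 : ℕ) + 2) * ρ ^ 0 * p * q := by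
          push_cast; ring
  | succ n ih =>
    -- `w^{n+3} = w^{n+2} · w`
    have e : ∀ w : 𝔸, w ^ (n + 1 + 2) = w ^ (n + 2) * w := fun w => by rw [show n + 1 + 2 = n + 2 + 1 by ring, pow_succ]
    rw [e, e, e, e]
    have hf : ∀ {w : 𝔸}, ‖w‖ ≤ ρ → ‖w ^ (n + 2)‖ ≤ ρ ^ (n + 2) := fun hw =>
      (norm_pow_le' _ (by omega)).trans (pow_le_pow_left₀ (norm_nonneg _) hw _)
    have hL : ∀ (x y : 𝔸) (s : ℝ), ‖x‖ ≤ ρ → ‖y‖ ≤ ρ → ‖x - y‖ ≤ s →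
        ‖x ^ (n + 2) - y ^ (n + 2)‖ ≤ (n + 2) * ρ ^ (n + 1) * s := by
      intro x y s hx hy hs
      have h := norm_pow_succ_sub_pow_succ_le' hx hy (n + 1)
      push_cast at h
      calc _ ≤ (↑n + 1 + 1) * ρ ^ (n + 1) * ‖x - y‖ := h
        _ ≤ (↑n + 1 + 1) * ρ ^ (n + 1) * s := by gcongr
        _ = _ := by ring
    have hB : 0 ≤ (n + 2) * ρ ^ (n + 1) * m + (n + 1) * (n + 2) * ρ ^ n * p * q := by positivity
    have t1 := mul_le_mul ih h₁₁ (norm_nonneg _) hB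
    have t2 := mul_le_mul (hL _ _ _ h₁₂ h₂₂ hp₂) hq₁ (norm_nonneg _) (by positivity)
    have t3 := mul_le_mul (hL _ _ _ h₂₁ h₂₂ hq₂) hp₁ (norm_nonneg _) (by positivity)
    have t4 := mul_le_mul (hf h₂₂) hm (norm_nonneg _) (by positivity)
    have h := norm_incr2_mul_le (w₁₁ ^ (n + 2)) (w₂₁ ^ (n + 2)) (w₁₂ ^ (n + 2)) (w₂₂ ^ (n + 2)) w₁₁ w₂₁ w₁₂ w₂₂
    calc ‖w₁₁ ^ (n + 2) * w₁₁ - w₂₁ ^ (n + 2) * w₂₁ - w₁₂ ^ (n + 2) * w₁₂ + w₂₂ ^ (n + 2) * w₂₂‖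
        ≤ ‖w₁₁ ^ (n + 2) - w₂₁ ^ (n + 2) - w₁₂ ^ (n + 2) + w₂₂ ^ (n + 2)‖ * ‖w₁₁‖ +
            ‖w₁₂ ^ (n + 2) - w₂₂ ^ (n + 2)‖ * ‖w₁₁ - w₁₂‖ + ‖w₂₁ ^ (n + 2) - w₂₂ ^ (n + 2)‖ * ‖w₁₁ - w₂₁‖ +
            ‖w₂₂ ^ (n + 2)‖ * ‖w₁₁ - w₂₁ - w₁₂ + w₂₂‖ := h
      _ ≤ ((n + 2) * ρ ^ (n + 1) * m + (n + 1) * (n + 2) * ρ ^ n * p * q) * ρ +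
            ((n + 2) * ρ ^ (n + 1) * p) * q + ((n + 2) * ρ ^ (n + 1) * q) * p + ρ ^ (n + 2) * m := by
          linarith
      _ = (↑(n + 1) + 2) * ρ ^ (n + 1 + 1) * m + (↑(n + 1) + 1) * (↑(n + 1) + 2) * ρ ^ (n + 1) * p * q := by
          push_cast; ring

/-- Real series: `Σ_{n≥0} (n+1)ρⁿ = 1/(1−ρ)²` for `0 ≤ ρ < 1`. [folklore] -/
private theorem hasSum_succ_mul_geometric {ρ : ℝ} (hρ0 : 0 ≤ ρ) (hρ : ρ < 1) :
    HasSum (fun n : ℕ => ((n : ℝ) + 1) * ρ ^ n) (1 / (1 - ρ) ^ 2) := by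
  have h1 : HasSum (fun n : ℕ => (n : ℝ) * ρ ^ n) (ρ / (1 - ρ) ^ 2) :=
    hasSum_coe_mul_geometric_of_norm_lt_one (by rwa [Real.norm_eq_abs, abs_of_nonneg hρ0])
  have h2 : HasSum (fun n : ℕ => ρ ^ n) (1 - ρ)⁻¹ := hasSum_geometric_of_lt_one hρ0 hρ
  have h := h1.add h2
  have hne : (1 - ρ) ≠ 0 := by linarith
  have e1 : (fun n : ℕ => ((n : ℝ) + 1) * ρ ^ n) = fun n : ℕ => (n : ℝ) * ρ ^ n + ρ ^ n := by
    funext n; ring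
  have e2 : 1 / (1 - ρ) ^ 2 = ρ / (1 - ρ) ^ 2 + (1 - ρ)⁻¹ := by
    field_simp; ring
  rw [e1, e2]; exact h

/-- **Second increment of the logarithmic tail `L(w) = log(1+w) − w`.**  Under the hypotheses of `norm_incr2_pow_le` with `ρ < 1`:
`‖L(w₁₁) − L(w₂₁) − L(w₁₂) + L(w₂₂)‖ ≤ ρm/(1−ρ) + pq/(1−ρ)²` (termwise on `Σ_{n≥2} c_n wⁿ`, `|c_n|·n = 1`). [folklore] -/
private theorem norm_incr2_logTail_le {w₁₁ w₂₁ w₁₂ w₂₂ : 𝔸} {ρ p q m : ℝ} (h₁₁ : ‖w₁₁‖ ≤ ρ) (h₂₁ : ‖w₂₁‖ ≤ ρ)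
    (h₁₂ : ‖w₁₂‖ ≤ ρ) (h₂₂ : ‖w₂₂‖ ≤ ρ) (hρ : ρ < 1) (hp₁ : ‖w₁₁ - w₂₁‖ ≤ p) (hp₂ : ‖w₁₂ - w₂₂‖ ≤ p)
    (hq₁ : ‖w₁₁ - w₁₂‖ ≤ q) (hq₂ : ‖w₂₁ - w₂₂‖ ≤ q) (hm : ‖w₁₁ - w₂₁ - w₁₂ + w₂₂‖ ≤ m) :
    ‖(logOnePlus w₁₁ - w₁₁) - (logOnePlus w₂₁ - w₂₁) - (logOnePlus w₁₂ - w₁₂) + (logOnePlus w₂₂ - w₂₂)‖ ≤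
      ρ * m / (1 - ρ) + p * q / (1 - ρ) ^ 2 := by
  have hρ0 : 0 ≤ ρ := (norm_nonneg _).trans h₁₁
  have hp : 0 ≤ p := (norm_nonneg _).trans hp₁
  have hq : 0 ≤ q := (norm_nonneg _).trans hq₁
  have hm0 : 0 ≤ m := (norm_nonneg _).trans hm
  have hs := (((hasSum_logOnePlus_sub_self (h₁₁.trans_lt hρ)).sub (hasSum_logOnePlus_sub_self (h₂₁.trans_lt hρ))).sub
    (hasSum_logOnePlus_sub_self (h₁₂.trans_lt hρ))).add (hasSum_logOnePlus_sub_self (h₂₂.trans_lt hρ))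
  -- the real majorant `Σ (ρ^{n+1} m + (n+1) ρ^n p q)`
  have hreal : HasSum (fun n : ℕ => ρ ^ (n + 1) * m + ((n : ℝ) + 1) * ρ ^ n * (p * q))
      (ρ * m / (1 - ρ) + p * q / (1 - ρ) ^ 2) := by
    have hg : HasSum (fun n : ℕ => ρ ^ (n + 1) * m) (ρ * m / (1 - ρ)) := by
      have h := ((hasSum_geometric_of_lt_one hρ0 hρ).mul_left ρ).mul_right m
      have e1 : (fun n : ℕ => ρ ^ (n + 1) * m) = fun n : ℕ => ρ * ρ ^ n * m := by
        funext n; ring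
      have e2 : ρ * m / (1 - ρ) = ρ * (1 - ρ)⁻¹ * m := by
        rw [div_eq_mul_inv]; ring
      rw [e1, e2]; exact h
    have hk : HasSum (fun n : ℕ => ((n : ℝ) + 1) * ρ ^ n * (p * q)) (p * q / (1 - ρ) ^ 2) := by
      have h := (hasSum_succ_mul_geometric hρ0 hρ).mul_right (p * q)
      have e2 : p * q / (1 - ρ) ^ 2 = 1 / (1 - ρ) ^ 2 * (p * q) := by ring
      rw [e2]; exact h
    exact hg.add hk
  refine hs.norm_le_of_bounded hreal fun n => ?_
  have e : logSeriesCoeff (n + 2) • w₁₁ ^ (n + 2) - logSeriesCoeff (n + 2) • w₂₁ ^ (n + 2) -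
        logSeriesCoeff (n + 2) • w₁₂ ^ (n + 2) + logSeriesCoeff (n + 2) • w₂₂ ^ (n + 2) =
      logSeriesCoeff (n + 2) • (w₁₁ ^ (n + 2) - w₂₁ ^ (n + 2) - w₁₂ ^ (n + 2) + w₂₂ ^ (n + 2)) := by
    simp only [smul_sub, smul_add]
  rw [e]
  have hc' := norm_logSeriesCoeff_succ_mul (n + 1)
  push_cast at hc'
  have hc : ‖logSeriesCoeff (n + 2)‖ * ((n : ℝ) + 2) = 1 := by
    rw [show (n : ℝ) + 2 = n + 1 + 1 by ring]; exact hc'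
  have hP := norm_incr2_pow_le h₁₁ h₂₁ h₁₂ h₂₂ hp₁ hp₂ hq₁ hq₂ hm n
  have hc0 : 0 ≤ ‖logSeriesCoeff (n + 2)‖ := norm_nonneg _
  calc ‖logSeriesCoeff (n + 2) • (w₁₁ ^ (n + 2) - w₂₁ ^ (n + 2) - w₁₂ ^ (n + 2) + w₂₂ ^ (n + 2))‖
      ≤ ‖logSeriesCoeff (n + 2)‖ * ‖w₁₁ ^ (n + 2) - w₂₁ ^ (n + 2) - w₁₂ ^ (n + 2) + w₂₂ ^ (n + 2)‖ := norm_smul_le _ _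
    _ ≤ ‖logSeriesCoeff (n + 2)‖ * ((n + 2) * ρ ^ (n + 1) * m + (n + 1) * (n + 2) * ρ ^ n * p * q) :=
        mul_le_mul_of_nonneg_left hP hc0
    _ = (‖logSeriesCoeff (n + 2)‖ * ((n : ℝ) + 2)) * (ρ ^ (n + 1) * m + (n + 1) * ρ ^ n * (p * q)) := by ring
    _ = ρ ^ (n + 1) * m + ((n : ℝ) + 1) * ρ ^ n * (p * q) := by rw [hc, one_mul]

/-! ## §2. The BCH remainder `G(X, Y) = log(e^X e^Y) − X − Y`: second increment and bilinear Lipschitz bound -/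

/-- Real arithmetic of the constant: for `0 ≤ r ≤ 1/8` and `ρ = e^r − 1`,
`e^r + ρe^r/(1−ρ) + e^{2r}/(1−ρ)² ≤ 4` (`ρ ≤ r + r² ≤ 9/64`). [folklore] -/
private theorem incr2Const_le {r : ℝ} (hr0 : 0 ≤ r) (hr : r ≤ 1 / 8) :
    Real.exp r + (Real.exp r - 1) * Real.exp r / (1 - (Real.exp r - 1)) +
      Real.exp r ^ 2 / (1 - (Real.exp r - 1)) ^ 2 ≤ 4 := by
  set ρ := Real.exp r - 1 with hρ
  have hρr : ρ ≤ r + r ^ 2 := by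
    have h := Real.abs_exp_sub_one_sub_id_le (x := r) (by rw [abs_of_nonneg hr0]; linarith)
    have := (abs_le.mp h).2
    rw [hρ]; linarith
  have hρ0 : 0 ≤ ρ := by rw [hρ]; linarith [Real.add_one_le_exp r]
  have hρ1 : ρ ≤ 9 / 64 := by nlinarith
  have hden : 55 / 64 ≤ 1 - ρ := by linarith
  have hE : Real.exp r = 1 + ρ := by rw [hρ]; ring
  rw [hE]
  have t2 : ρ * (1 + ρ) / (1 - ρ) ≤ 1 / 5 := by
    rw [div_le_iff₀ (by linarith)]; nlinarith
  have t3 : (1 + ρ) ^ 2 / (1 - ρ) ^ 2 ≤ 9 / 5 := by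
    rw [div_le_iff₀ (by positivity)]; nlinarith
  linarith

/-- **Second increment of the BCH remainder.**  For `‖X₁‖, ‖X₂‖ ≤ a`, `‖Y₁‖, ‖Y₂‖ ≤ a′`, `a + a′ ≤ 1/8`, the remainder
`G(X, Y) = log(e^X e^Y) − (X + Y)` (`bchLog X Y − (X + Y)`, the `Z − X − Y` of (30)–(31)) satisfies
`‖G(X₁,Y₁) − G(X₂,Y₁) − G(X₁,Y₂) + G(X₂,Y₂)‖ ≤ 4‖X₁ − X₂‖‖Y₁ − Y₂‖` — the mixed second difference is bilinearly small
(«from the structure of this power series expansion»: here termwise on the logarithmic series, no commutator expansion; standard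
Banach-algebra content, our proof). [cite: Balaban1985Averaging, (30)-(31) p.22] -/
theorem norm_bchRem_incr2_le {X₁ X₂ Y₁ Y₂ : 𝔸} {a a' : ℝ} (hX₁ : ‖X₁‖ ≤ a) (hX₂ : ‖X₂‖ ≤ a) (hY₁ : ‖Y₁‖ ≤ a')
    (hY₂ : ‖Y₂‖ ≤ a') (hr : a + a' ≤ 1 / 8) :
    ‖(bchLog X₁ Y₁ - (X₁ + Y₁)) - (bchLog X₂ Y₁ - (X₂ + Y₁)) - (bchLog X₁ Y₂ - (X₁ + Y₂)) +
        (bchLog X₂ Y₂ - (X₂ + Y₂))‖ ≤ 4 * ‖X₁ - X₂‖ * ‖Y₁ - Y₂‖ := by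
  have ha : 0 ≤ a := (norm_nonneg _).trans hX₁
  have ha' : 0 ≤ a' := (norm_nonneg _).trans hY₁
  set r := a + a' with hr_def
  set ρ := Real.exp r - 1 with hρ
  set dX := ‖X₁ - X₂‖ with hdX
  set dY := ‖Y₁ - Y₂‖ with hdY
  have hdX0 : 0 ≤ dX := norm_nonneg _
  have hdY0 : 0 ≤ dY := norm_nonneg _
  have hρ0 : 0 ≤ ρ := by rw [hρ]; linarith [Real.add_one_le_exp r]
  have hρr : ρ ≤ r + r ^ 2 := by
    have h := Real.abs_exp_sub_one_sub_id_le (x := r) (by rw [abs_of_nonneg (by positivity)]; linarith)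
    have := (abs_le.mp h).2
    rw [hρ]; linarith
  have hρ1 : ρ < 1 := by nlinarith
  -- the four letters `w_{ij} = e^{X_i}e^{Y_j} − 1`
  set w₁₁ := exp X₁ * exp Y₁ - 1 with hw₁₁
  set w₂₁ := exp X₂ * exp Y₁ - 1 with hw₂₁
  set w₁₂ := exp X₁ * exp Y₂ - 1 with hw₁₂
  set w₂₂ := exp X₂ * exp Y₂ - 1 with hw₂₂
  have n₁₁ : ‖w₁₁‖ ≤ ρ := norm_exp_mul_exp_sub_one_le_of_le (add_le_add hX₁ hY₁)
  have n₂₁ : ‖w₂₁‖ ≤ ρ := norm_exp_mul_exp_sub_one_le_of_le (add_le_add hX₂ hY₁)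
  have n₁₂ : ‖w₁₂‖ ≤ ρ := norm_exp_mul_exp_sub_one_le_of_le (add_le_add hX₁ hY₂)
  have n₂₂ : ‖w₂₂‖ ≤ ρ := norm_exp_mul_exp_sub_one_le_of_le (add_le_add hX₂ hY₂)
  -- exponentials are Lipschitz on balls (no `‖1‖ = 1`)
  have eX : ‖exp X₁ - exp X₂‖ ≤ Real.exp a * dX := by
    simpa [expTail] using norm_expTail_sub_expTail_le hX₁ hX₂ 0
  have eY : ‖exp Y₁ - exp Y₂‖ ≤ Real.exp a' * dY := by
    simpa [expTail] using norm_expTail_sub_expTail_le hY₁ hY₂ 0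
  have hEr : Real.exp r = Real.exp a * Real.exp a' := by rw [hr_def, Real.exp_add]
  -- first increments in `X`: `w₁ⱼ − w₂ⱼ = (e^{X₁} − e^{X₂})e^{Y_j}`
  have hp : ∀ (Y : 𝔸), ‖Y‖ ≤ a' → ‖(exp X₁ * exp Y - 1) - (exp X₂ * exp Y - 1)‖ ≤ Real.exp r * dX := by
    intro Y hY
    have e : (exp X₁ * exp Y - 1) - (exp X₂ * exp Y - 1) = (exp X₁ - exp X₂) * exp Y := by noncomm_ring
    rw [e]
    calc ‖(exp X₁ - exp X₂) * exp Y‖ ≤ ‖exp X₁ - exp X₂‖ * Real.exp ‖Y‖ := norm_mul_exp_le _ _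
      _ ≤ Real.exp a * dX * Real.exp a' :=
          mul_le_mul eX (Real.exp_le_exp.mpr hY) (Real.exp_pos _).le (by positivity)
      _ = Real.exp r * dX := by rw [hEr]; ring
  -- first increments in `Y`: `w_{i1} − w_{i2} = e^{X_i}(e^{Y₁} − e^{Y₂})`
  have hq : ∀ (X : 𝔸), ‖X‖ ≤ a → ‖(exp X * exp Y₁ - 1) - (exp X * exp Y₂ - 1)‖ ≤ Real.exp r * dY := by
    intro X hX
    have e : (exp X * exp Y₁ - 1) - (exp X * exp Y₂ - 1) = exp X * (exp Y₁ - exp Y₂) := by noncomm_ring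
    rw [e]
    calc ‖exp X * (exp Y₁ - exp Y₂)‖ ≤ Real.exp ‖X‖ * ‖exp Y₁ - exp Y₂‖ := norm_exp_mul_le ℂ _ _
      _ ≤ Real.exp a * (Real.exp a' * dY) :=
          mul_le_mul (Real.exp_le_exp.mpr hX) eY (norm_nonneg _) (Real.exp_pos _).le
      _ = Real.exp r * dY := by rw [hEr]; ring
  -- second increment of `w`: `(e^{X₁} − e^{X₂})(e^{Y₁} − e^{Y₂})`
  have hm : ‖w₁₁ - w₂₁ - w₁₂ + w₂₂‖ ≤ Real.exp r * dX * dY := by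
    have e : w₁₁ - w₂₁ - w₁₂ + w₂₂ = (exp X₁ - exp X₂) * (exp Y₁ - exp Y₂) := by
      rw [hw₁₁, hw₂₁, hw₁₂, hw₂₂]; noncomm_ring
    rw [e]
    calc ‖(exp X₁ - exp X₂) * (exp Y₁ - exp Y₂)‖ ≤ ‖exp X₁ - exp X₂‖ * ‖exp Y₁ - exp Y₂‖ := norm_mul_le _ _
      _ ≤ Real.exp a * dX * (Real.exp a' * dY) := mul_le_mul eX eY (norm_nonneg _) (by positivity)
      _ = Real.exp r * dX * dY := by rw [hEr]; ring
  -- the logarithmic tail, termwise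
  have hlog := norm_incr2_logTail_le n₁₁ n₂₁ n₁₂ n₂₂ hρ1 (hp Y₁ hY₁) (hp Y₂ hY₂) (hq X₁ hX₁) (hq X₂ hX₂) hm
  -- assemble: `G_{ij} = L(w_{ij}) + (w_{ij} − X_i − Y_j)`, the linear terms cancel in `Δ²`
  have hsplit : (bchLog X₁ Y₁ - (X₁ + Y₁)) - (bchLog X₂ Y₁ - (X₂ + Y₁)) - (bchLog X₁ Y₂ - (X₁ + Y₂)) +
        (bchLog X₂ Y₂ - (X₂ + Y₂)) =
      ((logOnePlus w₁₁ - w₁₁) - (logOnePlus w₂₁ - w₂₁) - (logOnePlus w₁₂ - w₁₂) + (logOnePlus w₂₂ - w₂₂)) +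
        (w₁₁ - w₂₁ - w₁₂ + w₂₂) := by
    simp only [bchLog, ← hw₁₁, ← hw₂₁, ← hw₁₂, ← hw₂₂]; abel
  rw [hsplit]
  refine (norm_add_le_of_le hlog hm).trans ?_
  have hK : Real.exp r + ρ * Real.exp r / (1 - ρ) + Real.exp r ^ 2 / (1 - ρ) ^ 2 ≤ 4 := by
    rw [hρ]; exact incr2Const_le (by positivity) hr
  have hdd : 0 ≤ dX * dY := mul_nonneg hdX0 hdY0
  calc ρ * (Real.exp r * dX * dY) / (1 - ρ) + Real.exp r * dX * (Real.exp r * dY) / (1 - ρ) ^ 2 +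
        Real.exp r * dX * dY
      = (Real.exp r + ρ * Real.exp r / (1 - ρ) + Real.exp r ^ 2 / (1 - ρ) ^ 2) * (dX * dY) := by ring
    _ ≤ 4 * (dX * dY) := mul_le_mul_of_nonneg_right hK hdd
    _ = 4 * dX * dY := by ring

/-- **Bilinear size of the BCH remainder** — the printed (31) in the vocabulary of `B12Membership313II.bchLog`:
`‖log(e^X e^Y) − (X + Y)‖ ≤ 2‖X‖‖Y‖` for `‖X‖ + ‖Y‖ ≤ 1/5` (the tree's `B7Eq31BCH.eq31_of_sum_le` BY NAME;
`bchLog X Y = MatrixLog.mlog (e^X e^Y)` definitionally). [cite: Balaban1985Averaging, (31) p.22] -/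
theorem norm_bchRem_le_two_mul {X Y : 𝔸} (h : ‖X‖ + ‖Y‖ ≤ 1 / 5) :
    ‖bchLog X Y - (X + Y)‖ ≤ 2 * ‖X‖ * ‖Y‖ := by
  have e : bchLog X Y - (X + Y) = MatrixLog.mlog (exp X * exp Y) - X - Y := by
    rw [bchLog, MatrixLog.mlog_def, sub_sub]
  rw [e]
  exact B7Eq31BCH.eq31_of_sum_le h

/-- **Bilinear Lipschitz bound of the BCH remainder.**  For `‖X₁‖, ‖X₂‖ ≤ a`, `‖Y₁‖, ‖Y₂‖ ≤ a′`, `a + a′ ≤ 1/8`: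
`‖G(X₁,Y₁) − G(X₂,Y₂)‖ ≤ 4(a′‖X₁ − X₂‖ + a‖Y₁ − Y₂‖)` — the Lipschitz constant in `X` is small with the size of `Y` and
conversely (`G(X, 0) = G(0, Y) = 0` since `log e^X = X`; two second increments).  Compare the tree's
`B12Membership313II.norm_bchRem_sub_bchRem_le`: `≤ 3(a + a′)(‖X₁ − X₂‖ + ‖Y₁ − Y₂‖)`. [cite: Balaban1985Averaging, (30)-(31) p.22] -/
theorem norm_bchRem_sub_bchRem_le_sharp {X₁ Y₁ X₂ Y₂ : 𝔸} {a a' : ℝ} (hX₁ : ‖X₁‖ ≤ a) (hX₂ : ‖X₂‖ ≤ a)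
    (hY₁ : ‖Y₁‖ ≤ a') (hY₂ : ‖Y₂‖ ≤ a') (hr : a + a' ≤ 1 / 8) :
    ‖(bchLog X₁ Y₁ - (X₁ + Y₁)) - (bchLog X₂ Y₂ - (X₂ + Y₂))‖ ≤ 4 * (a' * ‖X₁ - X₂‖ + a * ‖Y₁ - Y₂‖) := by
  have ha : 0 ≤ a := (norm_nonneg _).trans hX₁
  have ha' : 0 ≤ a' := (norm_nonneg _).trans hY₁
  have h0a : ‖(0 : 𝔸)‖ ≤ a := by rw [norm_zero]; exact ha
  have h0a' : ‖(0 : 𝔸)‖ ≤ a' := by rw [norm_zero]; exact ha'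
  -- exactness at `0`: `G(X, 0) = 0`, `G(0, Y) = 0`
  have hX0 : ∀ (X : 𝔸), ‖X‖ ≤ a → bchLog X 0 - (X + 0) = 0 := fun X hX => by
    rw [bchLog_zero_right (hX.trans (by linarith)), add_zero, sub_self]
  have h0Y : ∀ (Y : 𝔸), ‖Y‖ ≤ a' → bchLog 0 Y - (0 + Y) = 0 := fun Y hY => by
    rw [bchLog_zero_left (hY.trans (by linarith)), zero_add, sub_self]
  set G₁₁ := bchLog X₁ Y₁ - (X₁ + Y₁) with hG₁₁
  set G₂₁ := bchLog X₂ Y₁ - (X₂ + Y₁) with hG₂₁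
  set G₂₂ := bchLog X₂ Y₂ - (X₂ + Y₂) with hG₂₂
  -- vary `X` at `Y₁` (second increment against `Y₂ := 0`)
  have h1 : ‖G₁₁ - G₂₁‖ ≤ 4 * ‖X₁ - X₂‖ * ‖Y₁‖ := by
    have h := norm_bchRem_incr2_le hX₁ hX₂ hY₁ h0a' hr
    rw [hX0 X₁ hX₁, hX0 X₂ hX₂, sub_zero, add_zero, sub_zero] at h
    exact h
  -- vary `Y` at `X₂` (second increment against `X := 0`)
  have h2 : ‖G₂₁ - G₂₂‖ ≤ 4 * ‖X₂‖ * ‖Y₁ - Y₂‖ := by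
    have h := norm_bchRem_incr2_le hX₂ h0a hY₁ hY₂ hr
    rw [h0Y Y₁ hY₁, h0Y Y₂ hY₂, sub_zero, add_zero, sub_zero] at h
    exact h
  have e : G₁₁ - G₂₂ = (G₁₁ - G₂₁) + (G₂₁ - G₂₂) := by abel
  rw [e]
  calc ‖(G₁₁ - G₂₁) + (G₂₁ - G₂₂)‖ ≤ 4 * ‖X₁ - X₂‖ * ‖Y₁‖ + 4 * ‖X₂‖ * ‖Y₁ - Y₂‖ := norm_add_le_of_le h1 h2
    _ ≤ 4 * ‖X₁ - X₂‖ * a' + 4 * a * ‖Y₁ - Y₂‖ := by gcongr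
    _ = 4 * (a' * ‖X₁ - X₂‖ + a * ‖Y₁ - Y₂‖) := by ring

/-! ## §3. The composed potential `newPot ξ A A′ = (iξ)⁻¹log(e^{iξA}e^{iξA′})`: bilinear size, sharp covariant difference -/

/-- **Bilinear size of the BCH correction of the composed potential** (condition (ii) for a product `e^{iξA}e^{iξA′}`):
`‖newPot ξ A A′ − (A + A′)‖ ≤ 2ξ‖A‖‖A′‖` for `ξ(‖A‖ + ‖A′‖) ≤ 1/5`, `ξ > 0` ((31) at `X = iξA`, `Y = iξA′`).  Compare
`B12Membership313II.norm_newPot_le` (`3ξ(‖A‖ + ‖A′‖)²`). [cite: Balaban1987RG1, (1.13) p.262] -/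
theorem norm_newPot_sub_add_le {ξ : ℝ} (hξ : 0 < ξ) {A A' : 𝔸} (h : ξ * (‖A‖ + ‖A'‖) ≤ 1 / 5) :
    ‖newPot ξ A A' - (A + A')‖ ≤ 2 * ξ * ‖A‖ * ‖A'‖ := by
  rw [newPot_sub_add hξ.ne', norm_I_mul_inv_smul hξ]
  have hX : ‖(I * ξ) • A‖ + ‖(I * ξ) • A'‖ ≤ 1 / 5 := by
    rw [norm_I_mul_smul hξ.le, norm_I_mul_smul hξ.le]; linarith
  have h31 := norm_bchRem_le_two_mul hX
  rw [norm_I_mul_smul hξ.le, norm_I_mul_smul hξ.le] at h31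
  calc ξ⁻¹ * ‖bchLog ((I * ξ) • A) ((I * ξ) • A') - ((I * ξ) • A + (I * ξ) • A')‖
      ≤ ξ⁻¹ * (2 * (ξ * ‖A‖) * (ξ * ‖A'‖)) := by gcongr
    _ = 2 * ξ * ‖A‖ * ‖A'‖ := by field_simp

/-- **Size of the composed potential**: `‖newPot ξ A A′‖ ≤ ‖A‖ + ‖A′‖ + 2ξ‖A‖‖A′‖` for `ξ(‖A‖ + ‖A′‖) ≤ 1/5`.
[cite: Balaban1987RG1, (1.13) p.262] -/
theorem norm_newPot_le_sharp {ξ : ℝ} (hξ : 0 < ξ) {A A' : 𝔸} (h : ξ * (‖A‖ + ‖A'‖) ≤ 1 / 5) :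
    ‖newPot ξ A A'‖ ≤ ‖A‖ + ‖A'‖ + 2 * ξ * ‖A‖ * ‖A'‖ :=
  calc ‖newPot ξ A A'‖ ≤ ‖A + A'‖ + ‖newPot ξ A A' - (A + A')‖ := norm_le_norm_add_norm_sub' _ _
    _ ≤ ‖A‖ + ‖A'‖ + 2 * ξ * ‖A‖ * ‖A'‖ := add_le_add (norm_add_le _ _) (norm_newPot_sub_add_le hξ h)

/-- **Sharp first-order bound for the covariant difference of the composed potential** (the `∇^ξ_U A″` of condition (ii)
for `A″ = newPot ξ A A′`): if `ξ‖A‖, ξ‖uA₁u⁻¹‖ ≤ a`, `ξ‖A′‖, ξ‖uA′₁u⁻¹‖ ≤ a′`, `a + a′ ≤ 1/8`, then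
`‖ξ⁻¹(u·newPot ξ A₁ A′₁·u⁻¹ − newPot ξ A A′)‖ ≤ (1 + 4a′)‖ξ⁻¹(uA₁u⁻¹ − A)‖ + (1 + 4a)‖ξ⁻¹(uA′₁u⁻¹ − A′)‖` — each
constituent's covariant derivative enters with a factor `1 + O(size of the OTHER constituent)` (bilinear Lipschitz bound
`norm_bchRem_sub_bchRem_le_sharp`).  Compare `B12Membership313II.norm_covD_newPot_le`: `(1 + 3(a + a′))(d₁ + d₂)`.
[cite: Balaban1987RG1, (1.13) p.262] -/
theorem norm_covD_newPot_le_sharp (u : 𝔸ˣ) {ξ a a' : ℝ} (hξ : 0 < ξ) {A A' A₁ A'₁ : 𝔸}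
    (hw : ‖exp ((I * ξ) • A₁) * exp ((I * ξ) • A'₁) - 1‖ < 1)
    (h₁ : ξ * ‖A‖ ≤ a) (h₂ : ξ * ‖(u : 𝔸) * A₁ * ↑u⁻¹‖ ≤ a) (h₃ : ξ * ‖A'‖ ≤ a')
    (h₄ : ξ * ‖(u : 𝔸) * A'₁ * ↑u⁻¹‖ ≤ a') (hr : a + a' ≤ 1 / 8) :
    ‖(ξ : ℂ)⁻¹ • ((u : 𝔸) * newPot ξ A₁ A'₁ * ↑u⁻¹ - newPot ξ A A')‖ ≤
      (1 + 4 * a') * ‖(ξ : ℂ)⁻¹ • ((u : 𝔸) * A₁ * ↑u⁻¹ - A)‖ +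
        (1 + 4 * a) * ‖(ξ : ℂ)⁻¹ • ((u : 𝔸) * A'₁ * ↑u⁻¹ - A')‖ := by
  have ha : 0 ≤ a := le_trans (by positivity) h₁
  have ha' : 0 ≤ a' := le_trans (by positivity) h₃
  rw [conj_newPot_sub_newPot_eq u hξ.ne' hw]
  set At := (u : 𝔸) * A₁ * ↑u⁻¹ with hAt
  set At' := (u : 𝔸) * A'₁ * ↑u⁻¹ with hAt'
  set D₁ := At - A with hD₁
  set D₂ := At' - A' with hD₂
  set ΔG := (bchLog ((I * ξ) • At) ((I * ξ) • At') - ((I * ξ) • At + (I * ξ) • At')) -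
      (bchLog ((I * ξ) • A) ((I * ξ) • A') - ((I * ξ) • A + (I * ξ) • A')) with hΔG
  have hG : ‖ΔG‖ ≤ 4 * (a' * ‖(I * ξ) • At - (I * ξ) • A‖ + a * ‖(I * ξ) • At' - (I * ξ) • A'‖) :=
    norm_bchRem_sub_bchRem_le_sharp (by rwa [norm_I_mul_smul hξ.le]) (by rwa [norm_I_mul_smul hξ.le])
      (by rwa [norm_I_mul_smul hξ.le]) (by rwa [norm_I_mul_smul hξ.le]) hr
  rw [← smul_sub, ← smul_sub, norm_I_mul_smul hξ.le, norm_I_mul_smul hξ.le, ← hD₁, ← hD₂] at hG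
  have e1 : ‖D₁‖ = ξ * ‖(ξ : ℂ)⁻¹ • D₁‖ := norm_eq_mul_norm_inv_smul hξ D₁
  have e2 : ‖D₂‖ = ξ * ‖(ξ : ℂ)⁻¹ • D₂‖ := norm_eq_mul_norm_inv_smul hξ D₂
  set d₁ := ‖(ξ : ℂ)⁻¹ • D₁‖
  set d₂ := ‖(ξ : ℂ)⁻¹ • D₂‖
  rw [e1, e2] at hG
  have hT : ‖(ξ : ℂ)⁻¹ • ((I * ξ)⁻¹ • ΔG)‖ ≤ 4 * (a' * d₁ + a * d₂) := by
    rw [norm_smul, norm_I_mul_inv_smul hξ, norm_inv, Complex.norm_real, Real.norm_eq_abs, abs_of_pos hξ]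
    calc ξ⁻¹ * (ξ⁻¹ * ‖ΔG‖) ≤ ξ⁻¹ * (ξ⁻¹ * (4 * (a' * (ξ * (ξ * d₁)) + a * (ξ * (ξ * d₂))))) := by gcongr
      _ = 4 * (a' * d₁ + a * d₂) := by field_simp
  rw [smul_add, smul_add]
  calc ‖(ξ : ℂ)⁻¹ • D₁ + (ξ : ℂ)⁻¹ • D₂ + (ξ : ℂ)⁻¹ • ((I * ξ)⁻¹ • ΔG)‖
      ≤ ‖(ξ : ℂ)⁻¹ • D₁‖ + ‖(ξ : ℂ)⁻¹ • D₂‖ + ‖(ξ : ℂ)⁻¹ • ((I * ξ)⁻¹ • ΔG)‖ := norm_add₃_le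
    _ ≤ d₁ + d₂ + 4 * (a' * d₁ + a * d₂) := by gcongr
    _ = (1 + 4 * a') * d₁ + (1 + 4 * a) * d₂ := by ring

end

end Literature.MathematicalPhysics.QuantumFieldTheory.Balaban1983to89.B12Spaces329BCH
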